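/-
Copyright (c) 2026 the pub-hodgecm-mathlib formalisation cell (harness21).  Prover seat hodgecm-mathlib-LH4-p04 (g5), Track A «(D-RAM) FOUR-FRAME», unit U2H, the census leaf
(ρ2b′-X) `stub_U2H_fixedPointCensus_typeTwo_unit0` — socket (C) (type RamM bottom, dealer WORD #30: lead LH4-p04 + LH4-p06), organ T5s-RamM EDITION 2 (this lineage's head ★ p857711
with the PARITY TOKEN relaxed to «parity OR window» and the NEAR top-cell letter relaxed to «both sides equal»).  2026-09-04.
-/
import Summits.HodgeConjecture.HodgeConjecture.Theorems.F0P3cDyRamToricCensusSumRamM   -- ★ p857711 (LH4-p04 (g4)) + ★ p857695 Parts: `tables_diff_ramM`, `col_zero_ramM`, `col_pos_ramM`; ★ p857624 blocks, ★ p857321 tools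
import HarnessLib

/-!
# T5s «TORIC CENSUS SUM», TYPE RamM — EDITION 2: the parity token relaxed, the near top-cell letter relaxed

★ p857711 `toricCensusSum_ramM` (this lineage, g4) binds the token `hpar : m ≡ g + s0 (2)` and, on the diagonal top cells, the letter «alive iff bit» on BOTH sides for the NEAR cells
(`j + a + 2 ≤ m + s0 + 2g`).  Reading F0P3a-p01 (g32)'s E1 RamM rows again (LH4-p04 (g5), 2026-09-04T07:0xZ): REALISABLE tokens of BOTH parities occur at every depth — the
off-parity rows are exactly `jl = m + s0 − 1` (cells A∕B∕C: `jl = m`, cell D: `jl = m + 1`; LH4-p06 (g5)'s prediction 06:51Z), all inside the window `jl + 2 ≤ m + 2g + s0` — and the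
identity holds on them with the SAME closed form (twin `head_twin_ramM.v1` re-run: on-parity 432∕432, off-parity-in-window 268∕268, off-parity-off-window 0∕150).  Moreover on the
near top cells only the DIFFERENCE `vP − vM = 0` enters the sum, while the per-cell truth there need not be «alive iff bit» in every regime (LH4-p06 (g5) ⚠ 06:51Z).  Hence:
* §1 **`toricCensusSum_ramM_parityOrWindow`** — ★ p857711 VERBATIM except `hpar` ↦ `hparW : m % 2 = (g + s0) % 2 ∨ jl + 2 ≤ m + 2 * g + s0`; g4's proof goes through unchanged
  (the parity is used only in the non-window branch, where `hparW` yields it).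
* §2 **`toricCensusSum_ramM_v2`** — additionally `hvTop` ↦ (`hvTopNear` : near top cells have `vP = vM`) + (`hvTopFar` : far top cells carry `[bit ∧ ε = ±1]·2q^{j − (k′+1)∕2}`);
  proof: replace the near top values by ★ p857711's letters (same on both sides, so the sum is unchanged) and apply §1.
This is the T5s head the (C) weld (`toricCensusSum_ramM_weld`, LH4-p04 (g5)) consumes; ★ p857711 stays true and ★ (a corollary of §1).
HONEST LABEL: HC_CM is proved only modulo the 7 printed citations (2 remaining named inputs: hLiu418 = stmt-HodgeConjecture-24832, h413 = stmt-HodgeConjecture-24833) until rung 0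
closes; count-neutral (`--supports`); an arithmetic identity in hypothesis form — nothing printed is asserted; (ρ2b′-X) OPEN.

## References
* [Kottwitz1986BaseChangeUnits] R. E. Kottwitz, *Base change for unit elements of Hecke algebras*, Compositio Math. 60 (1986), §1 pp. 240–241.
* [Rogawski1990] J. D. Rogawski, *Automorphic Representations of Unitary Groups in Three Variables*, Ann. of Math. Stud. 123 (1990), §4.9 Prop. 4.9.1 (b) p. 55, Lemma 4.9.3 p. 56.
* [Flicker1998UnitaryFL] Y. Z. Flicker, *Elementary proof of the fundamental lemma for a unitary group*, Canad. J. Math. 50 (1998): Prop. 7 p. 84.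
* [Serre1979] J.-P. Serre, *Local Fields*, GTM 67 (1979): Ch. V §3 Cor. 3.
-/

set_option autoImplicit false

namespace Summit.HodgeConjecture.HodgeConjecture.Cruxes.H413.F0P3cDyRamToricCensusSumRamMV2

open Finset
open Summit.HodgeConjecture.HodgeConjecture.Cruxes.H413.F0P3cDyRamToricCensusSumUnrBlocks (sum_range_window_reindex geom_sum_mul')
open Summit.HodgeConjecture.HodgeConjecture.Cruxes.H413.F0P3cDyRamToricCensusSumRamKParts (genBlock_mul topBlock_mul)
open Summit.HodgeConjecture.HodgeConjecture.Cruxes.H413.F0P3cDyRamToricCensusSumRamMParts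

/-! ## §1 The parity token relaxed to «parity OR window» -/

/-- **T5s, TYPE RamM — PARITY OR WINDOW.**  ★ p857711 `toricCensusSum_ramM` verbatim (same tables `hnP hnM`, same depth rules `hvGen hvOff hvTop`, same closed form) with the
parity token relaxed: `hparW : m ≡ g + s0 (2) ∨ jl + 2 ≤ m + 2g + s0` (off-parity tokens are admitted inside the window, where the identity still holds; g4's proof uses the parity
only off the window).  `ε·Σ_{j ≤ jl} Σ_a q^a (vP j a − vM j a) = q^m·(2[n_H + 1]_q − 2[S]_q)`, `2n_H = jl − g`, `S = (g+s0) − (g+s0)%2`.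
[cite: Kottwitz1986BaseChangeUnits, §1 pp. 240–241] [cite: Rogawski1990, §4.9 Prop. 4.9.1 (b) p. 55, Lemma 4.9.3 p. 56] [cite: Flicker1998UnitaryFL, Prop. 7 p. 84] [cite: Serre1979, Ch. V §3 Cor. 3] -/
theorem toricCensusSum_ramM_parityOrWindow (q : ℕ) {g s0 jl m : ℕ} (ε : ℚ) (hq : 2 ≤ q) (hg : 1 ≤ g) (hs0 : 1 ≤ s0) (hjl : jl % 2 = g % 2)
    (hjlS : 3 * g + 2 * s0 ≤ jl + 2 + 2 * ((g + s0) % 2)) (hparW : m % 2 = (g + s0) % 2 ∨ jl + 2 ≤ m + 2 * g + s0) (hmS : g + s0 - (g + s0) % 2 ≤ m + 1) (hm : m ≤ jl)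
    (hε : ε = 1 ∨ (ε = -1 ∧ jl + 2 ≤ m + 2 * g + s0))
    (nP nM vP vM : ℕ → ℕ → ℚ)
    (hnP : ∀ j a, nP j a = ((if j = 0 then (if a = 0 then 1 else 0) else if j < a then 0
      else if j - a + 1 = s0 then q ^ j else if j - a + 1 < s0 then (if a = 0 then q ^ j else 0) else if (j - a - s0) % 2 = 1 then 0
      else if a = 0 then (if 2 * g ≤ j - a - s0 then 2 else 1) * q ^ (j - (j - a - s0) / 2)
      else if j - a - s0 + 2 < 2 * g then (q - 1) * q ^ (j - 1 - (j - a - s0) / 2) else if j - a - s0 + 2 = 2 * g then (q - 2) * q ^ (j - 1 - (j - a - s0) / 2)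
      else 2 * (q - 1) * q ^ (j - 1 - (j - a - s0) / 2) : ℕ) : ℚ))
    (hnM : ∀ j a, nM j a = ((if j = 0 then (if a = 0 then 1 else 0) else if j < a then 0
      else if j - a + 1 = s0 then q ^ j else if j - a + 1 < s0 then (if a = 0 then q ^ j else 0) else if (j - a - s0) % 2 = 1 then 0
      else if a = 0 then (if j - a - s0 + 2 ≤ 2 * g then q ^ (j - (j - a - s0) / 2) else 0)
      else if j - a - s0 + 2 < 2 * g then (q - 1) * q ^ (j - 1 - (j - a - s0) / 2) else if j - a - s0 + 2 = 2 * g then q ^ (j - (j - a - s0) / 2) else 0 : ℕ) : ℚ))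
    (hvGen : ∀ j a, (a ≤ m ∧ (j + a ≤ m ∨ (2 * a ≤ m ∧ j + a ≤ jl))) → vP j a = nP j a ∧ vM j a = nM j a)
    (hvOff : ∀ j a, ¬ (a ≤ m ∧ (j + a ≤ m ∨ (2 * a ≤ m ∧ j + a ≤ jl))) → j + m ≠ jl + a → vP j a = 0 ∧ vM j a = 0)
    (hvTop : ∀ j a, ¬ (a ≤ m ∧ (j + a ≤ m ∨ (2 * a ≤ m ∧ j + a ≤ jl))) → j + m = jl + a →
      (vP j a = if 2 * j + (g + s0) ≤ 2 * jl + 1 ∧ (j + a + 2 ≤ m + s0 + 2 * g ∨ ε = 1) then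
          (if j + a < m + s0 then (q : ℚ) ^ j else (if 2 * g ≤ j + a - m - s0 + 1 then 2 else 1) * (q : ℚ) ^ (j - (j + a - m - s0 + 1) / 2)) else 0) ∧
      (vM j a = if 2 * j + (g + s0) ≤ 2 * jl + 1 ∧ (j + a + 2 ≤ m + s0 + 2 * g ∨ ε = -1) then
          (if j + a < m + s0 then (q : ℚ) ^ j else (if 2 * g ≤ j + a - m - s0 + 1 then 2 else 1) * (q : ℚ) ^ (j - (j + a - m - s0 + 1) / 2)) else 0)) :
    ε * ∑ j ∈ range (jl + 1), ∑ a ∈ range (jl + 2), (q : ℚ) ^ a * (vP j a - vM j a) =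
      (q : ℚ) ^ m * (2 * ∑ i ∈ range ((jl - g) / 2 + 1), (q : ℚ) ^ i - 2 * ∑ i ∈ range (g + s0 - (g + s0) % 2), (q : ℚ) ^ i) := by
  set x : ℚ := (q : ℚ) with hxq
  have hx1 : x ≠ 1 := by rw [hxq]; exact_mod_cast (show q ≠ 1 by omega)
  have hε' : ε = 1 ∨ ε = -1 := hε.imp_right And.left
  have hεε : ε * ε = 1 := by rcases hε' with rfl | rfl <;> norm_num
  have hδ : ∀ j a, nP j a - nM j a = if a + s0 ≤ j ∧ (j - (a + s0)) % 2 = 0 then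
      (if a = 0 then (if 2 * g ≤ j - s0 then 2 * x ^ (j - (j - s0) / 2) else 0)
       else (if j - a - s0 + 2 = 2 * g then -2 * x ^ (j - 1 - (j - a - s0) / 2)
         else if 2 * g < j - a - s0 + 2 then 2 * (x - 1) * x ^ (j - 1 - (j - a - s0) / 2) else 0)) else 0 := fun j a => by rw [hnP, hnM]; exact tables_diff_ramM q hq hg j a
  -- columns first
  rw [Finset.sum_comm, Finset.sum_range_succ', col_zero_ramM x hg nP nM vP vM hδ hvGen,
    Finset.sum_congr rfl (fun a _ => col_pos_ramM x ε hε' hg hm nP nM vP vM hδ hvGen hvOff hvTop (show 1 ≤ a + 1 by omega)),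
    Finset.sum_add_distrib, ← Finset.mul_sum]
  -- the RHS, multiplied by `x − 1`
  have hR : (x - 1) * (x ^ m * (2 * ∑ i ∈ range ((jl - g) / 2 + 1), x ^ i - 2 * ∑ i ∈ range (g + s0 - (g + s0) % 2), x ^ i)) =
      2 * x ^ m * (x ^ ((jl - g) / 2 + 1) - x ^ (g + s0 - (g + s0) % 2)) := by
    have h1 := geom_sum_mul' x ((jl - g) / 2 + 1)
    have h2 := geom_sum_mul' x (g + s0 - (g + s0) % 2)
    linear_combination (2 * x ^ m) * h1 - (2 * x ^ m) * h2
  -- the column `a = 0`, multiplied by `x − 1`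
  have hC0 : (x - 1) * (2 * x ^ (g + s0) * ∑ k ∈ range ((jl - s0) / 2 + 1 - g), x ^ k) = 2 * x ^ (g + s0) * (x ^ ((jl - s0) / 2 + 1 - g) - 1) := by
    have h1 := geom_sum_mul' x ((jl - s0) / 2 + 1 - g)
    linear_combination (2 * x ^ (g + s0)) * h1
  by_cases hreg : jl + 2 ≤ m + 2 * g + s0
  · ---------------------------------------------------------------- the window `ℓ ≤ 2d − 2`: the generic part cancels, the top cells give everything
    -- generic columns: `a + 1 ≤ ⌊jl∕2⌋ + 1 − d`
    have hG : ∀ a ∈ range (jl + 1), (if 2 * (a + 1) ≤ m ∧ 2 * g + 2 * (a + 1) + s0 ≤ jl + 2 then 2 * x ^ ((jl + s0) / 2 + (a + 1)) - 2 * (x + 1) * x ^ (2 * (a + 1) + (g + s0) - 2) else 0) =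
        (if 0 ≤ a ∧ a < 0 + ((jl - s0) / 2 + 1 - g) then 2 * x ^ ((jl + s0) / 2 + 1) * x ^ a - 2 * (x + 1) * x ^ (g + s0) * x ^ (2 * a) else 0) := by
      intro a _
      by_cases h : 2 * (a + 1) ≤ m ∧ 2 * g + 2 * (a + 1) + s0 ≤ jl + 2
      · rw [if_pos h, if_pos (by omega), show (jl + s0) / 2 + (a + 1) = ((jl + s0) / 2 + 1) + a by omega, pow_add, show 2 * (a + 1) + (g + s0) - 2 = (g + s0) + 2 * a by omega, pow_add]; ring
      · rw [if_neg h, if_neg (by omega)]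
    -- top cells: `m + S − ⌊jl∕2⌋ ≤ a + 1 ≤ m − ⌊d∕2⌋`
    have hT : ∀ a ∈ range (jl + 1), (if m < 2 * (a + 1) ∧ 2 * (a + 1) + (g + s0) ≤ 2 * m + 1 ∧ 2 * m + 2 * g + s0 ≤ jl + 2 * (a + 1) + 1 then 2 * x ^ ((jl + s0) / 2 + (a + 1)) else 0) =
        (if (m + (g + s0 - (g + s0) % 2) - (jl + s0) / 2 - 1) ≤ a ∧ a < (m + (g + s0 - (g + s0) % 2) - (jl + s0) / 2 - 1) + ((jl - g) / 2 + 1 - (g + s0 - (g + s0) % 2)) then 2 * x ^ (m + (g + s0 - (g + s0) % 2)) * x ^ (a - (m + (g + s0 - (g + s0) % 2) - (jl + s0) / 2 - 1)) else 0) := by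
      intro a _
      by_cases h : m < 2 * (a + 1) ∧ 2 * (a + 1) + (g + s0) ≤ 2 * m + 1 ∧ 2 * m + 2 * g + s0 ≤ jl + 2 * (a + 1) + 1
      · rw [if_pos h, if_pos (by omega), show (jl + s0) / 2 + (a + 1) = (m + (g + s0 - (g + s0) % 2)) + (a - (m + (g + s0 - (g + s0) % 2) - (jl + s0) / 2 - 1)) by omega, pow_add, ← mul_assoc]
      · rw [if_neg h, if_neg (by omega)]
    rw [Finset.sum_congr rfl hG, sum_range_window_reindex (fun a => 2 * x ^ ((jl + s0) / 2 + 1) * x ^ a - 2 * (x + 1) * x ^ (g + s0) * x ^ (2 * a)) (show 0 + ((jl - s0) / 2 + 1 - g) ≤ jl + 1 by omega),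
      Finset.sum_congr rfl hT, sum_range_window_reindex (fun a => 2 * x ^ (m + (g + s0 - (g + s0) % 2)) * x ^ (a - (m + (g + s0 - (g + s0) % 2) - (jl + s0) / 2 - 1)))
        (show (m + (g + s0 - (g + s0) % 2) - (jl + s0) / 2 - 1) + ((jl - g) / 2 + 1 - (g + s0 - (g + s0) % 2)) ≤ jl + 1 by omega)]
    simp_rw [zero_add, Nat.add_sub_cancel_left]
    have hA : (x - 1) * (∑ i ∈ range ((jl - s0) / 2 + 1 - g), (2 * x ^ ((jl + s0) / 2 + 1) * x ^ i - 2 * (x + 1) * x ^ (g + s0) * x ^ (2 * i)) + 2 * x ^ (g + s0) * ∑ k ∈ range ((jl - s0) / 2 + 1 - g), x ^ k) = 0 := by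
      rw [mul_add, genBlock_mul, hC0]
      have f1 : x ^ ((jl + s0) / 2 + 1) = x ^ ((jl - s0) / 2 + 1 - g) * x ^ (g + s0) := by rw [← pow_add]; congr 1; omega
      have f2 : x ^ (2 * ((jl - s0) / 2 + 1 - g)) = x ^ ((jl - s0) / 2 + 1 - g) * x ^ ((jl - s0) / 2 + 1 - g) := by rw [← pow_add]; congr 1; omega
      rw [f1, f2]; ring
    have hA' : ∑ i ∈ range ((jl - s0) / 2 + 1 - g), (2 * x ^ ((jl + s0) / 2 + 1) * x ^ i - 2 * (x + 1) * x ^ (g + s0) * x ^ (2 * i)) + 2 * x ^ (g + s0) * ∑ k ∈ range ((jl - s0) / 2 + 1 - g), x ^ k = 0 := by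
      rcases mul_eq_zero.1 hA with h | h
      · exact absurd (sub_eq_zero.1 h) hx1
      · exact h
    have hB : (x - 1) * ∑ i ∈ range ((jl - g) / 2 + 1 - (g + s0 - (g + s0) % 2)), 2 * x ^ (m + (g + s0 - (g + s0) % 2)) * x ^ i =
        (x - 1) * (x ^ m * (2 * ∑ i ∈ range ((jl - g) / 2 + 1), x ^ i - 2 * ∑ i ∈ range (g + s0 - (g + s0) % 2), x ^ i)) := by
      rw [topBlock_mul, hR]
      have f1 : x ^ ((jl - g) / 2 + 1) = x ^ (g + s0 - (g + s0) % 2) * x ^ ((jl - g) / 2 + 1 - (g + s0 - (g + s0) % 2)) := by rw [← pow_add]; congr 1; omega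
      rw [pow_add, f1]; ring
    have hB' := mul_left_cancel₀ (sub_ne_zero.2 hx1) hB
    rw [show ε * (∑ i ∈ range ((jl - s0) / 2 + 1 - g), (2 * x ^ ((jl + s0) / 2 + 1) * x ^ i - 2 * (x + 1) * x ^ (g + s0) * x ^ (2 * i)) +
          ε * ∑ i ∈ range ((jl - g) / 2 + 1 - (g + s0 - (g + s0) % 2)), 2 * x ^ (m + (g + s0 - (g + s0) % 2)) * x ^ i + 2 * x ^ (g + s0) * ∑ k ∈ range ((jl - s0) / 2 + 1 - g), x ^ k) =
        ε * (∑ i ∈ range ((jl - s0) / 2 + 1 - g), (2 * x ^ ((jl + s0) / 2 + 1) * x ^ i - 2 * (x + 1) * x ^ (g + s0) * x ^ (2 * i)) + 2 * x ^ (g + s0) * ∑ k ∈ range ((jl - s0) / 2 + 1 - g), x ^ k) +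
        ε * ε * ∑ i ∈ range ((jl - g) / 2 + 1 - (g + s0 - (g + s0) % 2)), 2 * x ^ (m + (g + s0 - (g + s0) % 2)) * x ^ i by ring,
      hA', hεε, mul_zero, zero_add, one_mul, hB']
  · ---------------------------------------------------------------- `ℓ ≥ 2d`: `ε = +1`, generic columns `a + 1 ≤ ⌊m∕2⌋`, top cells `⌊m∕2⌋ + 1 ≤ a + 1 ≤ m − ⌊d∕2⌋`
    have hε1 : ε = 1 := by rcases hε with h | ⟨_, h⟩; exact h; exact absurd h hreg
    have hpar : m % 2 = (g + s0) % 2 := hparW.resolve_right hreg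
    subst hε1
    have hG : ∀ a ∈ range (jl + 1), (if 2 * (a + 1) ≤ m ∧ 2 * g + 2 * (a + 1) + s0 ≤ jl + 2 then 2 * x ^ ((jl + s0) / 2 + (a + 1)) - 2 * (x + 1) * x ^ (2 * (a + 1) + (g + s0) - 2) else 0) =
        (if 0 ≤ a ∧ a < 0 + m / 2 then 2 * x ^ ((jl + s0) / 2 + 1) * x ^ a - 2 * (x + 1) * x ^ (g + s0) * x ^ (2 * a) else 0) := by
      intro a _
      by_cases h : 2 * (a + 1) ≤ m ∧ 2 * g + 2 * (a + 1) + s0 ≤ jl + 2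
      · rw [if_pos h, if_pos (by omega), show (jl + s0) / 2 + (a + 1) = ((jl + s0) / 2 + 1) + a by omega, pow_add, show 2 * (a + 1) + (g + s0) - 2 = (g + s0) + 2 * a by omega, pow_add]; ring
      · rw [if_neg h, if_neg (by omega)]
    have hT : ∀ a ∈ range (jl + 1), (if m < 2 * (a + 1) ∧ 2 * (a + 1) + (g + s0) ≤ 2 * m + 1 ∧ 2 * m + 2 * g + s0 ≤ jl + 2 * (a + 1) + 1 then 2 * x ^ ((jl + s0) / 2 + (a + 1)) else 0) =
        (if m / 2 ≤ a ∧ a < m / 2 + (m - (g + s0) / 2 - m / 2) then 2 * x ^ ((jl + s0) / 2 + m / 2 + 1) * x ^ (a - m / 2) else 0) := by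
      intro a _
      by_cases h : m < 2 * (a + 1) ∧ 2 * (a + 1) + (g + s0) ≤ 2 * m + 1 ∧ 2 * m + 2 * g + s0 ≤ jl + 2 * (a + 1) + 1
      · rw [if_pos h, if_pos (by omega), show (jl + s0) / 2 + (a + 1) = ((jl + s0) / 2 + m / 2 + 1) + (a - m / 2) by omega, pow_add, ← mul_assoc]
      · rw [if_neg h, if_neg (by omega)]
    rw [Finset.sum_congr rfl hG, sum_range_window_reindex (fun a => 2 * x ^ ((jl + s0) / 2 + 1) * x ^ a - 2 * (x + 1) * x ^ (g + s0) * x ^ (2 * a)) (show 0 + m / 2 ≤ jl + 1 by omega),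
      Finset.sum_congr rfl hT, sum_range_window_reindex (fun a => 2 * x ^ ((jl + s0) / 2 + m / 2 + 1) * x ^ (a - m / 2)) (show m / 2 + (m - (g + s0) / 2 - m / 2) ≤ jl + 1 by omega)]
    simp_rw [zero_add, Nat.add_sub_cancel_left, one_mul]
    apply mul_left_cancel₀ (sub_ne_zero.2 hx1)
    rw [mul_add, mul_add, genBlock_mul, topBlock_mul, hC0, hR]
    -- atoms: `x^r` (`r = ⌈m∕2⌉ − ⌊d∕2⌋`), `x^t` (`t = ⌊d∕2⌋ − 1`), `x^u` (`u = ⌊jl∕2⌋ − ⌊m∕2⌋ − d`), `x`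
    rcases Nat.mod_two_eq_zero_or_one (g + s0) with hδ | hδ
    · have f1 : x ^ ((jl + s0) / 2 + 1) = x ^ (m - (g + s0) / 2 - m / 2) * x ^ ((g + s0) / 2 - 1) * x ^ ((g + s0) / 2 - 1) * x ^ ((g + s0) / 2 - 1) * x ^ ((jl - s0) / 2 - m / 2 - g) * x * x * x * x := by
        simp only [← pow_add, ← pow_succ]; congr 1; omega
      have f2 : x ^ (m / 2) = x ^ (m - (g + s0) / 2 - m / 2) * x ^ ((g + s0) / 2 - 1) * x := by simp only [← pow_add, ← pow_succ]; congr 1; omega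
      have f3 : x ^ (g + s0) = x ^ ((g + s0) / 2 - 1) * x ^ ((g + s0) / 2 - 1) * x * x := by simp only [← pow_add, ← pow_succ]; congr 1; omega
      have f4 : x ^ (2 * (m / 2)) = x ^ (m - (g + s0) / 2 - m / 2) * x ^ (m - (g + s0) / 2 - m / 2) * x ^ ((g + s0) / 2 - 1) * x ^ ((g + s0) / 2 - 1) * x * x := by
        simp only [← pow_add, ← pow_succ]; congr 1; omega
      have f5 : x ^ ((jl + s0) / 2 + m / 2 + 1) = x ^ (m - (g + s0) / 2 - m / 2) * x ^ (m - (g + s0) / 2 - m / 2) * x ^ ((g + s0) / 2 - 1) * x ^ ((g + s0) / 2 - 1) * x ^ ((g + s0) / 2 - 1) * x ^ ((g + s0) / 2 - 1) *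
          x ^ ((jl - s0) / 2 - m / 2 - g) * x * x * x * x * x := by simp only [← pow_add, ← pow_succ]; congr 1; omega
      have f6 : x ^ ((jl - s0) / 2 + 1 - g) = x ^ (m - (g + s0) / 2 - m / 2) * x ^ ((g + s0) / 2 - 1) * x ^ ((jl - s0) / 2 - m / 2 - g) * x * x := by
        simp only [← pow_add, ← pow_succ]; congr 1; omega
      have f7 : x ^ m = x ^ (m - (g + s0) / 2 - m / 2) * x ^ (m - (g + s0) / 2 - m / 2) * x ^ ((g + s0) / 2 - 1) * x ^ ((g + s0) / 2 - 1) * x * x := by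
        simp only [← pow_add, ← pow_succ]; congr 1; omega
      have f8 : x ^ ((jl - g) / 2 + 1) = x ^ (m - (g + s0) / 2 - m / 2) * x ^ ((g + s0) / 2 - 1) * x ^ ((g + s0) / 2 - 1) * x ^ ((jl - s0) / 2 - m / 2 - g) * x * x * x := by
        simp only [← pow_add, ← pow_succ]; congr 1; omega
      have f9 : x ^ (g + s0 - (g + s0) % 2) = x ^ ((g + s0) / 2 - 1) * x ^ ((g + s0) / 2 - 1) * x * x := by simp only [← pow_add, ← pow_succ]; congr 1; omega
      rw [f1, f2, f3, f4, f5, f6, f7, f8, f9]; ring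
    · have f1 : x ^ ((jl + s0) / 2 + 1) = x ^ (m - (g + s0) / 2 - m / 2) * x ^ ((g + s0) / 2 - 1) * x ^ ((g + s0) / 2 - 1) * x ^ ((g + s0) / 2 - 1) * x ^ ((jl - s0) / 2 - m / 2 - g) * x * x * x * x := by
        simp only [← pow_add, ← pow_succ]; congr 1; omega
      have f2 : x ^ (m / 2) = x ^ (m - (g + s0) / 2 - m / 2) * x ^ ((g + s0) / 2 - 1) := by simp only [← pow_add]; congr 1; omega
      have f3 : x ^ (g + s0) = x ^ ((g + s0) / 2 - 1) * x ^ ((g + s0) / 2 - 1) * x * x * x := by simp only [← pow_add, ← pow_succ]; congr 1; omega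
      have f4 : x ^ (2 * (m / 2)) = x ^ (m - (g + s0) / 2 - m / 2) * x ^ (m - (g + s0) / 2 - m / 2) * x ^ ((g + s0) / 2 - 1) * x ^ ((g + s0) / 2 - 1) := by
        simp only [← pow_add]; congr 1; omega
      have f5 : x ^ ((jl + s0) / 2 + m / 2 + 1) = x ^ (m - (g + s0) / 2 - m / 2) * x ^ (m - (g + s0) / 2 - m / 2) * x ^ ((g + s0) / 2 - 1) * x ^ ((g + s0) / 2 - 1) * x ^ ((g + s0) / 2 - 1) * x ^ ((g + s0) / 2 - 1) *
          x ^ ((jl - s0) / 2 - m / 2 - g) * x * x * x * x := by simp only [← pow_add, ← pow_succ]; congr 1; omega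
      have f6 : x ^ ((jl - s0) / 2 + 1 - g) = x ^ (m - (g + s0) / 2 - m / 2) * x ^ ((g + s0) / 2 - 1) * x ^ ((jl - s0) / 2 - m / 2 - g) * x := by
        simp only [← pow_add, ← pow_succ]; congr 1; omega
      have f7 : x ^ m = x ^ (m - (g + s0) / 2 - m / 2) * x ^ (m - (g + s0) / 2 - m / 2) * x ^ ((g + s0) / 2 - 1) * x ^ ((g + s0) / 2 - 1) * x := by
        simp only [← pow_add, ← pow_succ]; congr 1; omega
      have f8 : x ^ ((jl - g) / 2 + 1) = x ^ (m - (g + s0) / 2 - m / 2) * x ^ ((g + s0) / 2 - 1) * x ^ ((g + s0) / 2 - 1) * x ^ ((jl - s0) / 2 - m / 2 - g) * x * x * x := by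
        simp only [← pow_add, ← pow_succ]; congr 1; omega
      have f9 : x ^ (g + s0 - (g + s0) % 2) = x ^ ((g + s0) / 2 - 1) * x ^ ((g + s0) / 2 - 1) * x * x := by simp only [← pow_add, ← pow_succ]; congr 1; omega
      rw [f1, f2, f3, f4, f5, f6, f7, f8, f9]; ring


/-! ## §2 The near top-cell letter relaxed to «both sides equal» -/

/-- **T5s, TYPE RamM — EDITION 2 (the head the (C) weld consumes).**  As §1, with ★ p857711's diagonal letter `hvTop` replaced by: `hvTopNear` — on the NEAR top cells
(`¬GEN`, `j + m = jl + a`, `j + a + 2 ≤ m + s0 + 2g`) the two sides AGREE, `vP j a = vM j a` (their common value is irrelevant to the sum); `hvTopFar` — on the FAR top cells the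
side-`ε` letter `vP j a = [2j + (g+s0) ≤ 2jl + 1 ∧ ε = 1]·2q^(j − (j + a − m − s0 + 1)∕2)`, `vM j a = [… ∧ ε = −1]·2q^(…)` (the far cells sit beyond the threshold, where the index
factor is `2` and `j + a ≥ m + s0`).  Same closed form.  Proof: substitute ★ p857711's letter on the near top cells of both sides (equal there) and apply §1.
[cite: Kottwitz1986BaseChangeUnits, §1 pp. 240–241] [cite: Rogawski1990, §4.9 Prop. 4.9.1 (b) p. 55, Lemma 4.9.3 p. 56] [cite: Flicker1998UnitaryFL, Prop. 7 p. 84] [cite: Serre1979, Ch. V §3 Cor. 3] -/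
theorem toricCensusSum_ramM_v2 (q : ℕ) {g s0 jl m : ℕ} (ε : ℚ) (hq : 2 ≤ q) (hg : 1 ≤ g) (hs0 : 1 ≤ s0) (hjl : jl % 2 = g % 2)
    (hjlS : 3 * g + 2 * s0 ≤ jl + 2 + 2 * ((g + s0) % 2)) (hparW : m % 2 = (g + s0) % 2 ∨ jl + 2 ≤ m + 2 * g + s0) (hmS : g + s0 - (g + s0) % 2 ≤ m + 1) (hm : m ≤ jl)
    (hε : ε = 1 ∨ (ε = -1 ∧ jl + 2 ≤ m + 2 * g + s0))
    (nP nM vP vM : ℕ → ℕ → ℚ)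
    (hnP : ∀ j a, nP j a = ((if j = 0 then (if a = 0 then 1 else 0) else if j < a then 0
      else if j - a + 1 = s0 then q ^ j else if j - a + 1 < s0 then (if a = 0 then q ^ j else 0) else if (j - a - s0) % 2 = 1 then 0
      else if a = 0 then (if 2 * g ≤ j - a - s0 then 2 else 1) * q ^ (j - (j - a - s0) / 2)
      else if j - a - s0 + 2 < 2 * g then (q - 1) * q ^ (j - 1 - (j - a - s0) / 2) else if j - a - s0 + 2 = 2 * g then (q - 2) * q ^ (j - 1 - (j - a - s0) / 2)
      else 2 * (q - 1) * q ^ (j - 1 - (j - a - s0) / 2) : ℕ) : ℚ))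
    (hnM : ∀ j a, nM j a = ((if j = 0 then (if a = 0 then 1 else 0) else if j < a then 0
      else if j - a + 1 = s0 then q ^ j else if j - a + 1 < s0 then (if a = 0 then q ^ j else 0) else if (j - a - s0) % 2 = 1 then 0
      else if a = 0 then (if j - a - s0 + 2 ≤ 2 * g then q ^ (j - (j - a - s0) / 2) else 0)
      else if j - a - s0 + 2 < 2 * g then (q - 1) * q ^ (j - 1 - (j - a - s0) / 2) else if j - a - s0 + 2 = 2 * g then q ^ (j - (j - a - s0) / 2) else 0 : ℕ) : ℚ))
    (hvGen : ∀ j a, (a ≤ m ∧ (j + a ≤ m ∨ (2 * a ≤ m ∧ j + a ≤ jl))) → vP j a = nP j a ∧ vM j a = nM j a)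
    (hvOff : ∀ j a, ¬ (a ≤ m ∧ (j + a ≤ m ∨ (2 * a ≤ m ∧ j + a ≤ jl))) → j + m ≠ jl + a → vP j a = 0 ∧ vM j a = 0)
    (hvTopNear : ∀ j a, ¬ (a ≤ m ∧ (j + a ≤ m ∨ (2 * a ≤ m ∧ j + a ≤ jl))) → j + m = jl + a → j + a + 2 ≤ m + s0 + 2 * g → vP j a = vM j a)
    (hvTopFar : ∀ j a, ¬ (a ≤ m ∧ (j + a ≤ m ∨ (2 * a ≤ m ∧ j + a ≤ jl))) → j + m = jl + a → ¬ (j + a + 2 ≤ m + s0 + 2 * g) →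
      (vP j a = if 2 * j + (g + s0) ≤ 2 * jl + 1 ∧ ε = 1 then 2 * (q : ℚ) ^ (j - (j + a - m - s0 + 1) / 2) else 0) ∧
      (vM j a = if 2 * j + (g + s0) ≤ 2 * jl + 1 ∧ ε = -1 then 2 * (q : ℚ) ^ (j - (j + a - m - s0 + 1) / 2) else 0)) :
    ε * ∑ j ∈ range (jl + 1), ∑ a ∈ range (jl + 2), (q : ℚ) ^ a * (vP j a - vM j a) =
      (q : ℚ) ^ m * (2 * ∑ i ∈ range ((jl - g) / 2 + 1), (q : ℚ) ^ i - 2 * ∑ i ∈ range (g + s0 - (g + s0) % 2), (q : ℚ) ^ i) := by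
  classical
  -- ★ p857711's letters on the two sides, and the primed tables (letters on the near top cells, the given values elsewhere)
  obtain ⟨LP, hLP⟩ : ∃ f : ℕ → ℕ → ℚ, f = fun j a => if 2 * j + (g + s0) ≤ 2 * jl + 1 ∧ (j + a + 2 ≤ m + s0 + 2 * g ∨ ε = 1) then
          (if j + a < m + s0 then (q : ℚ) ^ j else (if 2 * g ≤ j + a - m - s0 + 1 then 2 else 1) * (q : ℚ) ^ (j - (j + a - m - s0 + 1) / 2)) else 0 := ⟨_, rfl⟩
  obtain ⟨LM, hLM⟩ : ∃ f : ℕ → ℕ → ℚ, f = fun j a => if 2 * j + (g + s0) ≤ 2 * jl + 1 ∧ (j + a + 2 ≤ m + s0 + 2 * g ∨ ε = -1) then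
          (if j + a < m + s0 then (q : ℚ) ^ j else (if 2 * g ≤ j + a - m - s0 + 1 then 2 else 1) * (q : ℚ) ^ (j - (j + a - m - s0 + 1) / 2)) else 0 := ⟨_, rfl⟩
  obtain ⟨vP', hvP'⟩ : ∃ f : ℕ → ℕ → ℚ, f = fun j a =>
      if ¬ (a ≤ m ∧ (j + a ≤ m ∨ (2 * a ≤ m ∧ j + a ≤ jl))) ∧ j + m = jl + a ∧ j + a + 2 ≤ m + s0 + 2 * g then LP j a else vP j a := ⟨_, rfl⟩
  obtain ⟨vM', hvM'⟩ : ∃ f : ℕ → ℕ → ℚ, f = fun j a =>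
      if ¬ (a ≤ m ∧ (j + a ≤ m ∨ (2 * a ≤ m ∧ j + a ≤ jl))) ∧ j + m = jl + a ∧ j + a + 2 ≤ m + s0 + 2 * g then LM j a else vM j a := ⟨_, rfl⟩
  -- the letters agree on the near cells
  have hLeq : ∀ j a, j + a + 2 ≤ m + s0 + 2 * g → LP j a = LM j a := by
    intro j a hnear
    rw [hLP, hLM]; dsimp only
    by_cases hb : 2 * j + (g + s0) ≤ 2 * jl + 1
    · have hcP : 2 * j + (g + s0) ≤ 2 * jl + 1 ∧ (j + a + 2 ≤ m + s0 + 2 * g ∨ ε = 1) := ⟨hb, Or.inl hnear⟩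
      have hcM : 2 * j + (g + s0) ≤ 2 * jl + 1 ∧ (j + a + 2 ≤ m + s0 + 2 * g ∨ ε = -1) := ⟨hb, Or.inl hnear⟩
      rw [if_pos hcP, if_pos hcM]
    · have hcP : ¬ (2 * j + (g + s0) ≤ 2 * jl + 1 ∧ (j + a + 2 ≤ m + s0 + 2 * g ∨ ε = 1)) := fun h => hb h.1
      have hcM : ¬ (2 * j + (g + s0) ≤ 2 * jl + 1 ∧ (j + a + 2 ≤ m + s0 + 2 * g ∨ ε = -1)) := fun h => hb h.1
      rw [if_neg hcP, if_neg hcM]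
  have hvGen' : ∀ j a, (a ≤ m ∧ (j + a ≤ m ∨ (2 * a ≤ m ∧ j + a ≤ jl))) → vP' j a = nP j a ∧ vM' j a = nM j a := by
    intro j a hG
    have hc : ¬ (¬ (a ≤ m ∧ (j + a ≤ m ∨ (2 * a ≤ m ∧ j + a ≤ jl))) ∧ j + m = jl + a ∧ j + a + 2 ≤ m + s0 + 2 * g) := fun h => h.1 hG
    rw [hvP', hvM']; dsimp only
    rw [if_neg hc, if_neg hc]
    exact hvGen j a hG
  have hvOff' : ∀ j a, ¬ (a ≤ m ∧ (j + a ≤ m ∨ (2 * a ≤ m ∧ j + a ≤ jl))) → j + m ≠ jl + a → vP' j a = 0 ∧ vM' j a = 0 := by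
    intro j a hnG hoff
    have hc : ¬ (¬ (a ≤ m ∧ (j + a ≤ m ∨ (2 * a ≤ m ∧ j + a ≤ jl))) ∧ j + m = jl + a ∧ j + a + 2 ≤ m + s0 + 2 * g) := fun h => hoff h.2.1
    rw [hvP', hvM']; dsimp only
    rw [if_neg hc, if_neg hc]
    exact hvOff j a hnG hoff
  have hvTop' : ∀ j a, ¬ (a ≤ m ∧ (j + a ≤ m ∨ (2 * a ≤ m ∧ j + a ≤ jl))) → j + m = jl + a →
      (vP' j a = if 2 * j + (g + s0) ≤ 2 * jl + 1 ∧ (j + a + 2 ≤ m + s0 + 2 * g ∨ ε = 1) then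
          (if j + a < m + s0 then (q : ℚ) ^ j else (if 2 * g ≤ j + a - m - s0 + 1 then 2 else 1) * (q : ℚ) ^ (j - (j + a - m - s0 + 1) / 2)) else 0) ∧
      (vM' j a = if 2 * j + (g + s0) ≤ 2 * jl + 1 ∧ (j + a + 2 ≤ m + s0 + 2 * g ∨ ε = -1) then
          (if j + a < m + s0 then (q : ℚ) ^ j else (if 2 * g ≤ j + a - m - s0 + 1 then 2 else 1) * (q : ℚ) ^ (j - (j + a - m - s0 + 1) / 2)) else 0) := by
    intro j a hnG hdiag
    rw [hvP', hvM']; dsimp only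
    by_cases hnear : j + a + 2 ≤ m + s0 + 2 * g
    · have hc : ¬ (a ≤ m ∧ (j + a ≤ m ∨ (2 * a ≤ m ∧ j + a ≤ jl))) ∧ j + m = jl + a ∧ j + a + 2 ≤ m + s0 + 2 * g := ⟨hnG, hdiag, hnear⟩
      rw [if_pos hc, if_pos hc, hLP, hLM]
      exact ⟨rfl, rfl⟩
    · have hc : ¬ (¬ (a ≤ m ∧ (j + a ≤ m ∨ (2 * a ≤ m ∧ j + a ≤ jl))) ∧ j + m = jl + a ∧ j + a + 2 ≤ m + s0 + 2 * g) := fun h => hnear h.2.2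
      rw [if_neg hc, if_neg hc]
      obtain ⟨h1, h2⟩ := hvTopFar j a hnG hdiag hnear
      have hlt : ¬ (j + a < m + s0) := by omega
      have hfac : 2 * g ≤ j + a - m - s0 + 1 := by omega
      rw [h1, h2]
      constructor
      · by_cases hb : 2 * j + (g + s0) ≤ 2 * jl + 1 ∧ ε = 1
        · have hb' : 2 * j + (g + s0) ≤ 2 * jl + 1 ∧ (j + a + 2 ≤ m + s0 + 2 * g ∨ ε = 1) := ⟨hb.1, Or.inr hb.2⟩
          rw [if_pos hb, if_pos hb', if_neg hlt, if_pos hfac]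
        · have hb' : ¬ (2 * j + (g + s0) ≤ 2 * jl + 1 ∧ (j + a + 2 ≤ m + s0 + 2 * g ∨ ε = 1)) := fun h => hb ⟨h.1, h.2.resolve_left hnear⟩
          rw [if_neg hb, if_neg hb']
      · by_cases hb : 2 * j + (g + s0) ≤ 2 * jl + 1 ∧ ε = -1
        · have hb' : 2 * j + (g + s0) ≤ 2 * jl + 1 ∧ (j + a + 2 ≤ m + s0 + 2 * g ∨ ε = -1) := ⟨hb.1, Or.inr hb.2⟩
          rw [if_pos hb, if_pos hb', if_neg hlt, if_pos hfac]
        · have hb' : ¬ (2 * j + (g + s0) ≤ 2 * jl + 1 ∧ (j + a + 2 ≤ m + s0 + 2 * g ∨ ε = -1)) := fun h => hb ⟨h.1, h.2.resolve_left hnear⟩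
          rw [if_neg hb, if_neg hb']
  -- §1 on the primed tables, then compare the sums cell by cell
  have key := toricCensusSum_ramM_parityOrWindow q ε hq hg hs0 hjl hjlS hparW hmS hm hε nP nM vP' vM' hnP hnM hvGen' hvOff' hvTop'
  rw [← key]
  congr 1
  refine sum_congr rfl fun j _ => sum_congr rfl fun a _ => ?_
  congr 1
  rw [hvP', hvM']; dsimp only
  by_cases hc : ¬ (a ≤ m ∧ (j + a ≤ m ∨ (2 * a ≤ m ∧ j + a ≤ jl))) ∧ j + m = jl + a ∧ j + a + 2 ≤ m + s0 + 2 * g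
  · rw [if_pos hc, if_pos hc, hvTopNear j a hc.1 hc.2.1 hc.2.2, hLeq j a hc.2.2, sub_self, sub_self]
  · rw [if_neg hc, if_neg hc]

end Summit.HodgeConjecture.HodgeConjecture.Cruxes.H413.F0P3cDyRamToricCensusSumRamMV2
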